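import Summits.HodgeConjecture.HodgeConjecture.Theorems.WeilTypeLadderQuadraticVariationalOnPath
import HarnessLib

/-!
# WeilTypeLadder · the decomposition `R∞ ⟺ R∞anc ∧ R∞var` is EXACT (no strength is lost)

b2b cell `hweil` (packet `run/shared/lean/b2b/hodge-weil/`). Prover 2, generation 2 (variational). Gen 1 landed the
GLUE `R∞anc → R∞var → R∞` (`weilClassesImaginaryQuadratic_of_anchored_of_variational`). This file lands the two
converse edges — `R∞ → R∞var` (a Weil-confined class on a fibre is algebraic on the abelian chart) and `R∞ → R∞anc`
(the constant family over `Spec ℂ` anchored at `A` itself, exactly the construction of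
`anchoredWeilFamiliesQuadratic_of_hodgeConjecture` with HC replaced by R∞) — and the resulting EQUIVALENCE
`WeilClassesImaginaryQuadratic ↔ AnchoredWeilFamiliesQuadratic ∧ WeilVariationalHodgeQuadratic`: the two typed leaves
of the quadratic ladder are JOINTLY EQUIVALENT to Weil's question, so the carver's DAG edge R∞anc ∧ R∞var ⟹ R∞ is an
`↔`, and every unconditional result about one leaf (e.g. the transport leaf discharged at semiregular anchors,
`Theorems/WeilTypeLadderQuadraticVariationalEngine.lean`) is progress on R∞ itself with no slack. Sorry-free; no definition.
Serves stmt-HodgeConjecture-2522 (`↔` R∞) without closing it.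
-/

-- every declaration of this problem lives in `Summit.HodgeConjecture.HodgeConjecture.…` (summit = sub-problem)
set_option linter.dupNamespace false

noncomputable section

open CategoryTheory AlgebraicGeometry

namespace Summit.HodgeConjecture.HodgeConjecture.WeilTypeLadder

open Literature.AlgebraicGeometry Literature.AlgebraicGeometry.Motives
open Literature.AlgebraicGeometry.HodgeTheory
open Literature.AlgebraicTopology.SingularHomology
open Summit.HodgeConjecture.HodgeConjecture.Theorems

/-- **R∞ ⟹ R∞var**: if every rational `(n,n)` Weil class of every abelian `2n`-fold with `φ² = -d` is algebraic,
then in particular the Weil-confined fibre classes `W|_{𝒳_s}` of R∞var's families are (read on the abelian chart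
`e′ : A′.X ≅ 𝒳_s` and transported back; the anchor hypothesis is not even used). [folklore] -/
theorem weilVariationalHodgeQuadratic_of_weilClassesImaginaryQuadratic (h : WeilClassesImaginaryQuadratic) :
    WeilVariationalHodgeQuadratic := by
  intro n hn d hd 𝒳 S f hf _ _ _ _ W hW hWeil _ s
  obtain ⟨A', φ', e', hA'dim, hφ', hmem⟩ := hWeil s
  have hA'sp : IsSmoothProjective (2 * n) A'.X := by
    have h' := AbelianVariety.isSmoothProjective_holds (A := A')
    rw [AbelianVariety.isSmoothProjective, hA'dim] at h'
    exact h'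
  have halg : complexBetti.map e'.hom (2 * n) (complexBetti.map (fiberι f s) (2 * n) W) ∈
      algebraicClasses A'.X n :=
    h n hn d hd A' φ' hA'dim hA'sp hφ' _ ((hW s).1.map _) ((hW s).2.map_of_iso e') hmem
  exact (mem_algebraicClasses_map_iff_of_iso e').1 halg

/-- **R∞ ⟹ R∞anc**: the constant family `A.X ⟶ Spec ℂ` anchored at `A` itself (`c` algebraic by R∞; fibre
inclusions are isomorphisms; `Spec ℂ` quasi-projective, smooth, irreducible; `A.X` projective) — the construction
of `anchoredWeilFamiliesQuadratic_of_hodgeConjecture` verbatim, with the Hodge conjecture replaced by R∞. [folklore] -/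
theorem anchoredWeilFamiliesQuadratic_of_weilClassesImaginaryQuadratic (h : WeilClassesImaginaryQuadratic) :
    AnchoredWeilFamiliesQuadratic := by
  intro n hn d hd A φ hAdim hX hφ c hcQ hcH hc _
  have hfam : IsSmoothProjectiveFamily (toSpecOver A.X) (2 * n) := isSmoothProjectiveFamily_toSpecOver' hX
  let s : ComplexPoints (specOver ℂ ℂ) := 𝟙 (specOver ℂ ℂ)
  haveI : ∀ t : ComplexPoints (specOver ℂ ℂ), IsIso (fiberι (toSpecOver A.X) t) :=
    fun t => isIso_fiberι_toSpecOver' (X := A.X) t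
  let ι : A.X ≅ fiberOver (toSpecOver A.X) s := (asIso (fiberι (toSpecOver A.X) s)).symm
  have halg : c ∈ algebraicClasses A.X n := h n hn d hd A φ hAdim hX hφ c hcQ hcH hc
  have hback : ∀ t : ComplexPoints (specOver ℂ ℂ),
      complexBetti.map (asIso (fiberι (toSpecOver A.X) t)).symm.hom (2 * n)
        (complexBetti.map (fiberι (toSpecOver A.X) t) (2 * n) c) = c := fun t => by
    change (complexBetti.map (asIso (fiberι (toSpecOver A.X) t)).hom (2 * n) ≫
      complexBetti.map (asIso (fiberι (toSpecOver A.X) t)).inv (2 * n)) c = c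
    rw [← complexBetti.map_comp, Iso.inv_hom_id, complexBetti.map_id]
    rfl
  refine ⟨A.X, specOver ℂ ℂ, toSpecOver A.X, s, s, ι, c, hfam,
    IsQuasiProjectiveOver.of_isProjectiveOver hX.isProjectiveOver, IsQuasiProjectiveOver.specOver,
    inferInstanceAs (IrreducibleSpace (PrimeSpectrum ℂ)), ?_, ?_, ?_, hback s, ?_⟩
  · haveI : IsIso (specOver ℂ ℂ).hom := by rw [specOver_hom_eq_id]; exact IsIso.id _
    infer_instance
  · intro t
    exact ⟨hcQ.pullback _, IsOfHodgeType.map_of_iso (asIso (fiberι (toSpecOver A.X) t)) hcH⟩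
  · intro t
    refine ⟨A, φ, (asIso (fiberι (toSpecOver A.X) t)).symm, hAdim, hφ, ?_⟩
    rw [hback t]
    exact hc
  · exact (mem_algebraicClasses_map_iff_of_iso (asIso (fiberι (toSpecOver A.X) s))).2 halg

/-- **EXACTNESS of the quadratic decomposition: `R∞ ⟺ R∞anc ∧ R∞var`.** Weil's question for imaginary quadratic
`K` (every `n ≥ 2`, every `d`, every discriminant) is EQUIVALENT to the conjunction of its two typed leaves — anchor
supply and Weil-confined variational Hodge; `←` is gen 1's glue, `→` the two lemmas above. So nothing is lost in the
carver's DAG by attacking the leaves separately. [cite: Markman2025SecantWeil, Thm. 1.5.1 (strategy)] [folklore] -/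
theorem weilClassesImaginaryQuadratic_iff_anchored_and_variational :
    WeilClassesImaginaryQuadratic ↔ AnchoredWeilFamiliesQuadratic ∧ WeilVariationalHodgeQuadratic :=
  ⟨fun h ↦ ⟨anchoredWeilFamiliesQuadratic_of_weilClassesImaginaryQuadratic h,
      weilVariationalHodgeQuadratic_of_weilClassesImaginaryQuadratic h⟩,
    fun h ↦ weilClassesImaginaryQuadratic_of_anchored_of_variational h.1 h.2⟩

end Summit.HodgeConjecture.HodgeConjecture.WeilTypeLadder

end
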